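import Mathlib.NumberTheory.LocalField.Basic
import Mathlib.RingTheory.Ideal.Quotient.Index
import Mathlib.RingTheory.Filtration
import Mathlib.GroupTheory.OrderOfElement
import Literature.AnabelianGeometry.AbsoluteAnabelian.AbsTopIII.KummerFaithful
import Literature.AnabelianGeometry.AbsoluteAnabelian.MLFUnitsInfinitelyDivisible
import Literature.AnabelianGeometry.AbsoluteAnabelian.MLFGaloisModel
import Literature.NumberTheory.GaloisRepresentations.LocalFieldFiniteExtension
import HarnessLib

/-!
# [AbsTopIII] Def 1.5 / Rmk 1.5.4 (i), torus part, for Mathlib's non-archimedean local fields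

Proof-only companion (theorems only, no new definitions) of `AbsTopIII/KummerFaithful.lean`
(S. Mochizuki, *Topics in Absolute Anabelian Geometry III*, §1, Def. 1.5 p. 32 and Rmk. 1.5.4 (i)
p. 33, kurims manuscript, lit key `paper:url-5493eb38cbb7`).

The tree already kernel-checks "every MLF is torally Kummer-faithful" for MLF's presented as finite
extensions of `ℚ_p` (`isTorallyKummerFaithful_of_finite_padic`, `IsMLF.isTorallyKummerFaithful`, seat
abc-iut-L4-d2 / -t17).  The model data of [AbsTopIII] §3 (`MLFClosure` of `MLFGaloisModel.lean`, seat
abc-iut-L4-t2) presents an MLF instead through Mathlib's `IsNonarchimedeanLocalField k` + `CharZero k`,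
and the tree has no bridge between the two presentations.  This file proves the torus statement
directly for Mathlib's presentation, for use by the dischargers of [AbsTopIII] Prop. 3.2 (iv) /
Prop. 3.3 (ii) (`MonoidKummerMaps.lean`), whose Kummer-class arguments end in "`⋂_N (k'^×)^N = {1}`
for every finite extension `k'` of the base MLF `k`":

* `IsNonarchimedeanLocalField.valuation_eq_one_of_forall_pos_exists_pow_eq` — an element of a
  non-archimedean local field (any characteristic) with `n`-th roots for every `n ≥ 1` is a unit of
  the ring of integers;
* `IsNonarchimedeanLocalField.eq_one_of_forall_pos_exists_pow_eq` — such an element equals `1`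
  (finite quotients `𝒪/𝓂^k` and Krull's intersection theorem);
* `IsNonarchimedeanLocalField.divisibleElementsTrivial_units` — `⋂_N (K^×)^N = {1}`, i.e.
  `DivisibleElementsTrivial Kˣ` (Def. 1.5 (a) for `𝔾_m` over `K` itself);
* `isTorallyKummerFaithful_of_isNonarchimedeanLocalField` — a characteristic-zero non-archimedean
  local field is torally Kummer-faithful (Rmk. 1.5.4 (i), torus part; the finite extensions are again
  non-archimedean local fields by the tree's `FiniteExtension.isNonarchimedeanLocalField`);
* `MLFClosure.isTorallyKummerFaithful`, `MLFClosure.divisibleElementsTrivial_units_of_finite`,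
  `MLFClosure.eq_one_of_forall_pos_exists_pow_eq` — the same for the base field of the [AbsTopIII] §3
  model data (`MLFClosure`, `MLFGaloisModel.lean`) and for the finite intermediate extensions
  `k ⊆ k' ⊆ k̄` inside its algebraic closure;
* `MLFClosure.submonoid_equivariant_eq_self` — the KUMMER-CLASS STEP of Prop. 3.2 (iv) / Prop. 3.3 (ii)
  (pp. 72–74): a `Gal(k̄/k)`-equivariant multiplicative self-map of a Galois-stable submonoid
  `M ⊆ k̄^×` that is closed under roots and contains `μ_∞` (`𝒪_k̄^⊳`, `𝒪_k̄^×`, `k̄^×`), fixing every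
  root of unity, is the identity (infinite Galois correspondence `k̄^{Gal(k̄/k(x))} = k(x)` + the
  previous item).

HONEST FRAMING: OUR kernel check of a classical fact quoted (with proof sketch) by a refereed paper;
nothing here bears on [IUTchIII] Cor. 3.12.
-/

noncomputable section

namespace Literature.AnabelianGeometry.AbsoluteAnabelian.AbsTopIII

open _root_.ValuativeRel

universe u

section LocalField

variable (K : Type*) [Field K] [ValuativeRel K] [TopologicalSpace K] [IsNonarchimedeanLocalField K]

/-- In a non-archimedean local field, a non-zero element admitting `n`-th roots for every `n ≥ 1`
has valuation `1` (it has `2^n`-th roots for all `n`, so neither it nor its inverse can lie in the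
maximal ideal — `MLFUnitsInfinitelyDivisible`, Krull).  Rmk. 1.5.4 (i) p. 33: "if `k` [...] is a
finite extension of `ℚ_p`, then [...] the condition of Definition 1.5, (a), is satisfied".
[cite: MochizukiAbsTopIII2015, Rmk 1.5.4 (i) p.33] -/
theorem IsNonarchimedeanLocalField.valuation_eq_one_of_forall_pos_exists_pow_eq {x : K} (hx : x ≠ 0)
    (h : ∀ n : ℕ, 0 < n → ∃ y : K, y ^ n = x) : valuation K x = 1 := by
  have h2 : ∀ n : ℕ, ∃ y : K, y ^ 2 ^ n = x := fun n => h (2 ^ n) (Nat.two_pow_pos n)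
  by_cases hle : valuation K x ≤ 1
  · exact IsNonarchimedeanLocalField.valuation_eq_one_of_forall_exists_pow_eq K hx hle
      Nat.prime_two h2
  · exfalso
    have hlt : 1 < valuation K x := lt_of_not_ge hle
    have hxi : x⁻¹ ≠ 0 := inv_ne_zero hx
    have hle' : valuation K x⁻¹ ≤ 1 := by
      rw [map_inv₀]
      exact inv_le_one_of_one_le₀ hlt.le
    have h2' : ∀ n : ℕ, ∃ y : K, y ^ 2 ^ n = x⁻¹ := by
      intro n
      obtain ⟨y, hy⟩ := h2 n
      exact ⟨y⁻¹, by rw [inv_pow, hy]⟩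
    have h1 : valuation K x⁻¹ = 1 :=
      IsNonarchimedeanLocalField.valuation_eq_one_of_forall_exists_pow_eq K hxi hle'
        Nat.prime_two h2'
    rw [map_inv₀, inv_eq_one] at h1
    exact (ne_of_gt hlt) h1

/-- In a non-archimedean local field, a non-zero element admitting `n`-th roots for every `n ≥ 1`
equals `1`: it is a unit of `𝒪_K` (previous lemma), its roots are units, the unit groups of the
finite rings `𝒪_K/𝓂^k` are finite so the element is `≡ 1 (mod 𝓂^k)` for every `k` (Lagrange), and
`⋂_k 𝓂^k = 0` (Krull).  This is the content of Def. 1.5 (a) for `𝔾_m` over `K`.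
[cite: MochizukiAbsTopIII2015, Def 1.5 p.32] -/
theorem IsNonarchimedeanLocalField.eq_one_of_forall_pos_exists_pow_eq {x : K} (hx : x ≠ 0)
    (h : ∀ n : ℕ, 0 < n → ∃ y : K, y ^ n = x) : x = 1 := by
  have hv : valuation K x = 1 :=
    IsNonarchimedeanLocalField.valuation_eq_one_of_forall_pos_exists_pow_eq K hx h
  set xo : 𝒪[K] := ⟨x, (Valuation.mem_integer_iff _ _).mpr hv.le⟩ with hxo
  have hmem : ∀ k : ℕ, xo - 1 ∈ 𝓂[K] ^ k := by
    intro k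
    haveI : Finite (𝒪[K] ⧸ 𝓂[K]) := inferInstanceAs (Finite 𝓀[K])
    haveI : Finite (𝒪[K] ⧸ 𝓂[K] ^ k) :=
      Ideal.finite_quotient_pow (IsNoetherian.noetherian _) k
    set m : ℕ := Nat.card (𝒪[K] ⧸ 𝓂[K] ^ k)ˣ with hm
    have hm0 : 0 < m := Nat.card_pos
    obtain ⟨y, hy⟩ := h m hm0
    have hvy : valuation K y = 1 := by
      have hpow : valuation K y ^ m = 1 := by rw [← map_pow, hy, hv]
      exact (pow_eq_one_iff.mp hpow).resolve_right hm0.ne'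
    set yo : 𝒪[K] := ⟨y, (Valuation.mem_integer_iff _ _).mpr hvy.le⟩ with hyo
    have hyunit : IsUnit yo :=
      (Valuation.integer.integers (valuation K)).isUnit_of_one' hvy
    have hyx : yo ^ m = xo := Subtype.ext (by simp [hyo, hxo, hy])
    obtain ⟨u, hu⟩ := hyunit.map (Ideal.Quotient.mk (𝓂[K] ^ k))
    have hum : u ^ m = 1 := by rw [hm]; exact pow_card_eq_one'
    have h1 : Ideal.Quotient.mk (𝓂[K] ^ k) xo = Ideal.Quotient.mk (𝓂[K] ^ k) 1 := by
      rw [← hyx, map_pow, ← hu, ← Units.val_pow_eq_pow_val, hum, Units.val_one, map_one]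
    exact Ideal.Quotient.eq.mp h1
  have hbot : (⨅ k : ℕ, 𝓂[K] ^ k) = ⊥ :=
    Ideal.iInf_pow_eq_bot_of_isLocalRing _ (Ideal.IsMaximal.ne_top inferInstance)
  have hx1 : xo - 1 ∈ (⨅ k : ℕ, 𝓂[K] ^ k) := Ideal.mem_iInf.mpr hmem
  rw [hbot, Ideal.mem_bot, sub_eq_zero] at hx1
  have := congrArg Subtype.val hx1
  simpa [hxo] using this

/-- **Def 1.5 (a) for `𝔾_m` over a non-archimedean local field**: `⋂_N (K^×)^N = {1}`
(`DivisibleElementsTrivial Kˣ`), any characteristic.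
[cite: MochizukiAbsTopIII2015, Def 1.5 p.32] -/
theorem IsNonarchimedeanLocalField.divisibleElementsTrivial_units : DivisibleElementsTrivial Kˣ := by
  refine ⟨fun x hx => ?_⟩
  apply Units.ext
  refine IsNonarchimedeanLocalField.eq_one_of_forall_pos_exists_pow_eq K x.ne_zero fun n hn => ?_
  obtain ⟨y, hy⟩ := hx n hn
  exact ⟨(y : K), by rw [← Units.val_pow_eq_pow_val, hy]⟩

end LocalField

section TorallyKummerFaithful

open Literature.NumberTheory.GaloisRepresentations

/-- **Rmk 1.5.4 (i), torus part, for Mathlib's presentation of an MLF**: a non-archimedean local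
field of characteristic zero is torally Kummer-faithful — every finite extension `k'` is again a
non-archimedean local field (tree `FiniteExtension.isNonarchimedeanLocalField`, Serre *Local Fields*
II §2), so `⋂_N (k'^×)^N = {1}` by `divisibleElementsTrivial_units`.  ("if `k`, hence also `k_H`, is a
finite extension of `ℚ_p`, then [...] the condition of Definition 1.5, (a), is satisfied", p. 33.)
[cite: MochizukiAbsTopIII2015, Rmk 1.5.4 (i) p.33] -/
theorem isTorallyKummerFaithful_of_isNonarchimedeanLocalField (k : Type u) [Field k] [ValuativeRel k]
    [TopologicalSpace k] [IsNonarchimedeanLocalField k] [CharZero k] : IsTorallyKummerFaithful k := by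
  refine ⟨inferInstance, fun k' _ _ hfin => ?_⟩
  haveI : FiniteDimensional k k' := hfin
  letI := FiniteExtension.valuativeRel k k'
  letI := FiniteExtension.topologicalSpace k k'
  haveI := FiniteExtension.isNonarchimedeanLocalField k k'
  exact IsNonarchimedeanLocalField.divisibleElementsTrivial_units k'

end TorallyKummerFaithful

end Literature.AnabelianGeometry.AbsoluteAnabelian.AbsTopIII

/-! ### The [AbsTopIII] §3 model data: torus Kummer-faithfulness at the finite levels of `k̄/k`,
and the rigidity of Galois-equivariant multiplicative maps fixing the roots of unity -/

namespace Literature.AnabelianGeometry.AbsoluteAnabelian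

open AbsTopIII

universe u

/-- The base field `k` of the [AbsTopIII] §3 model data (`MLFClosure`: Mathlib
`IsNonarchimedeanLocalField k` + `CharZero k`) is torally Kummer-faithful.
[cite: MochizukiAbsTopIII2015, Rmk 1.5.4 (i) p.33] -/
theorem MLFClosure.isTorallyKummerFaithful (C : MLFClosure.{u}) : IsTorallyKummerFaithful C.k :=
  isTorallyKummerFaithful_of_isNonarchimedeanLocalField C.k

/-- For the model data `(k, k̄)` of [AbsTopIII] §3 and a finite intermediate extension
`k ⊆ k' ⊆ k̄`: `⋂_N (k'^×)^N = {1}` — the form in which the Kummer-class arguments of Prop. 3.2 (iv) /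
Prop. 3.3 (ii) consume torus Kummer-faithfulness ("by taking the invariants with respect to some open
subgroup of the Galois group", Rmk. 3.1.1 p. 70).
[cite: MochizukiAbsTopIII2015, Rmk 1.5.4 (i) p.33] -/
theorem MLFClosure.divisibleElementsTrivial_units_of_finite (C : MLFClosure.{u})
    (k' : IntermediateField C.k C.K) [FiniteDimensional C.k k'] : DivisibleElementsTrivial (k' : Type u)ˣ :=
  (MLFClosure.isTorallyKummerFaithful C).units k' inferInstance

/-- Pointwise form: for a finite intermediate extension `k ⊆ k' ⊆ k̄` of the model data, a non-zero
`x ∈ k'` that is an `n`-th power IN `k'` for every `n ≥ 1` equals `1`.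
[cite: MochizukiAbsTopIII2015, Rmk 1.5.4 (i) p.33] -/
theorem MLFClosure.eq_one_of_forall_pos_exists_pow_eq (C : MLFClosure.{u})
    (k' : IntermediateField C.k C.K) [FiniteDimensional C.k k'] {x : C.K} (hxk : x ∈ k') (hx : x ≠ 0)
    (h : ∀ n : ℕ, 0 < n → ∃ y : C.K, y ∈ k' ∧ y ^ n = x) : x = 1 := by
  have hD := MLFClosure.divisibleElementsTrivial_units_of_finite C k'
  set xu : (k' : Type u)ˣ := Units.mk0 ⟨x, hxk⟩ (by
    intro h0
    exact hx (by simpa using congrArg Subtype.val h0)) with hxu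
  have key : xu = 1 := by
    refine hD.eq_one_of_forall_exists_pow xu fun n hn => ?_
    obtain ⟨y, hyk, hy⟩ := h n hn
    have hy0 : (⟨y, hyk⟩ : k') ≠ 0 := by
      intro h0
      have : y = 0 := by simpa using congrArg Subtype.val h0
      rw [this, zero_pow hn.ne'] at hy
      exact hx hy.symm
    refine ⟨Units.mk0 ⟨y, hyk⟩ hy0, ?_⟩
    apply Units.ext
    simp only [Units.val_pow_eq_pow_val, Units.val_mk0, hxu]
    exact Subtype.ext (by simpa using hy)
  have := congrArg (fun u : (k' : Type u)ˣ => ((u : k') : C.K)) key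
  simpa [hxu] using this

/-- **Rigidity of Galois-equivariant multiplicative maps** (the Kummer-class step in the proofs of
[AbsTopIII] Prop. 3.2 (iv) "`Isom((Π ↷ M_T), (Π* ↷ M*_T)) ↪ Isom_{𝒯𝒢}(Π, Π*)`" and Prop. 3.3 (ii),
pp. 72–74): for the model data `(k, k̄)`, a `G_k`-stable submonoid `M ⊆ k̄` not containing `0`,
closed under extraction of roots and containing the roots of unity (`M ∈ {𝒪_k̄^⊳, 𝒪_k̄^×, k̄^×}`),
and a multiplicative map `β : M → M` commuting with `G_k = Gal(k̄/k)` and fixing every root of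
unity, `β` is the identity.  Proof: for `x ∈ M`, `k' := k(x)`, `H := Gal(k̄/k')` and an `n`-th root
`y ∈ M` of `x`, the cocycle `σ ↦ σy/y` (`σ ∈ H`) takes values in `μ_n`, which `β` fixes, so
`β(y)/y` is `H`-invariant, i.e. lies in `k'` (infinite Galois correspondence), and
`(β y / y)^n = β x / x`; hence `β x / x ∈ ⋂_n (k'^×)^n = {1}` by torus Kummer-faithfulness at the
finite level `k'`.
[cite: MochizukiAbsTopIII2015, Proposition 3.2 (iv) p.72] -/
theorem MLFClosure.submonoid_equivariant_eq_self (C : MLFClosure.{u}) (M : Submonoid C.K)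
    (hM : ∀ (σ : C.K ≃ₐ[C.k] C.K) (x : C.K), x ∈ M → σ x ∈ M)
    (hroot : ∀ x ∈ M, ∀ n : ℕ, 0 < n → ∃ y ∈ M, y ^ n = x)
    (hμ : ∀ (ζ : C.K) (n : ℕ), 0 < n → ζ ^ n = 1 → ζ ∈ M)
    (h0 : (0 : C.K) ∉ M) (β : M →* M)
    (hβσ : ∀ (σ : C.K ≃ₐ[C.k] C.K) (x : M), (β ⟨σ x, hM σ x x.2⟩ : C.K) = σ (β x))
    (hβμ : ∀ (x : M) (n : ℕ), 0 < n → (x : C.K) ^ n = 1 → β x = x) :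
    ∀ x : M, β x = x := by
  classical
  intro x
  have hx0 : (x : C.K) ≠ 0 := fun h => h0 (h ▸ x.2)
  have hβx0 : ((β x : M) : C.K) ≠ 0 := fun h => h0 (h ▸ (β x).2)
  -- the finite level `k' = k(x)` and its Galois group `H`
  haveI : Algebra.IsAlgebraic C.k C.K := inferInstance
  set k' : IntermediateField C.k C.K := IntermediateField.adjoin C.k {(x : C.K)} with hk'
  haveI : FiniteDimensional C.k k' :=
    IntermediateField.adjoin.finiteDimensional (Algebra.IsAlgebraic.isAlgebraic (x : C.K)).isIntegral
  set H : Subgroup (C.K ≃ₐ[C.k] C.K) := k'.fixingSubgroup with hH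
  have hxk : (x : C.K) ∈ k' := IntermediateField.subset_adjoin C.k {(x : C.K)} (Set.mem_singleton _)
  -- elements of `k̄` fixed by `H` lie in `k'`
  have hfix : ∀ z : C.K, (∀ σ ∈ H, σ z = z) → z ∈ k' := by
    intro z hz
    have hz' : z ∈ IntermediateField.fixedField H := (IntermediateField.mem_fixedField_iff H z).mpr hz
    rwa [hH, InfiniteGalois.fixedField_fixingSubgroup] at hz'
  have hHx : ∀ σ ∈ H, σ (x : C.K) = x := fun σ hσ =>
    (IntermediateField.mem_fixingSubgroup_iff _ _).mp hσ _ hxk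
  -- `β x ∈ k'`
  have hβxk : ((β x : M) : C.K) ∈ k' := by
    refine hfix _ fun σ hσ => ?_
    have h1 := hβσ σ x
    have h2 : (⟨σ x, hM σ x x.2⟩ : M) = x := Subtype.ext (hHx σ hσ)
    rw [h2] at h1
    exact h1.symm
  -- the quotient `β x / x ∈ k'` has `n`-th roots in `k'` for every `n`
  set u : C.K := ((β x : M) : C.K) / x with hu
  have huk : u ∈ k' := div_mem hβxk hxk
  have hu0 : u ≠ 0 := div_ne_zero hβx0 hx0
  have hun : ∀ n : ℕ, 0 < n → ∃ w : C.K, w ∈ k' ∧ w ^ n = u := by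
    intro n hn
    obtain ⟨y, hyM, hyx⟩ := hroot x x.2 n hn
    have hy0 : y ≠ 0 := fun h => h0 (h ▸ hyM)
    set yM : M := ⟨y, hyM⟩ with hyM'
    have hyMx : yM ^ n = x := Subtype.ext (by simpa [hyM'] using hyx)
    -- `β y / y` is `H`-invariant
    refine ⟨((β yM : M) : C.K) / y, hfix _ fun σ hσ => ?_, ?_⟩
    · -- the cocycle value `ζ = σ y / y` is an `n`-th root of unity, fixed by `β`
      set ζ : C.K := σ y / y with hζ
      have hζn : ζ ^ n = 1 := by
        rw [hζ, div_pow, ← map_pow, hyx, hHx σ hσ, div_self hx0]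
      have hζM : ζ ∈ M := hμ ζ n hn hζn
      have hβζ : β ⟨ζ, hζM⟩ = ⟨ζ, hζM⟩ := hβμ ⟨ζ, hζM⟩ n hn hζn
      have hσy : σ y = ζ * y := by rw [hζ, div_mul_cancel₀ _ hy0]
      have hprod : (⟨σ y, hM σ y hyM⟩ : M) = ⟨ζ, hζM⟩ * yM := Subtype.ext (by simpa [hyM'] using hσy)
      have h1 := hβσ σ yM
      rw [hprod, map_mul, hβζ] at h1
      -- h1 : ((⟨ζ, _⟩ * β yM : M) : K) = σ (β yM)
      have h1' : σ ((β yM : M) : C.K) = ζ * ((β yM : M) : C.K) := by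
        rw [← h1]; rfl
      have hζ0 : ζ ≠ 0 := by
        intro hz0
        rw [hz0, zero_pow hn.ne'] at hζn
        exact zero_ne_one hζn
      rw [map_div₀, h1', hσy, mul_div_mul_left _ _ hζ0]
    · rw [div_pow, hu, ← hyx]
      congr 1
      rw [← hyMx, map_pow]
      simp
  have hu1 : u = 1 := MLFClosure.eq_one_of_forall_pos_exists_pow_eq C k' huk hu0 hun
  -- conclude
  apply Subtype.ext
  have : ((β x : M) : C.K) = u * x := by rw [hu, div_mul_cancel₀ _ hx0]
  rw [this, hu1, one_mul]

end Literature.AnabelianGeometry.AbsoluteAnabelian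

end
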